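import Mathlib.LinearAlgebra.Complex.Module
import Mathlib.NumberTheory.NumberField.CanonicalEmbedding.Basic
import Literature.NumberTheory.Automorphic.RealCasimirGL
import HarnessLib

/-!
# Self-dual systems of units: `ℝ`, `ℂ`, products, powers, and `K_∞ = mixedSpace K`

Topic `NumberTheory/Automorphic`; sequel of `RealCasimirGL`, which attaches to a **self-dual
system of units** `F : SelfDualUnits A S` of a commutative real Banach `*`-algebra `A` (finitely
many `u_s ∈ A` with signs `ε_s = ±1`, `star u_s = ε_s u_s`, spanning `A` over `ℝ`, with the
Frobenius identity `∑ ε_s (x u_s) ⊗ u_s = ∑ ε_s u_s ⊗ (u_s x)`) the real Casimir element of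
`𝔤𝔩(N, A)` and Nelson's sum-of-squares decomposition. This file CONSTRUCTS such systems:

* `SelfDualUnits.real` (`A = ℝ`: the unit `1`), `SelfDualUnits.complex` (`A = ℂ` as a real
  algebra: the units `1, i` with signs `1, -1`);
* `SelfDualUnits.prod` (`A × B` from systems of `A` and `B`), `SelfDualUnits.pi` (`ι → B` from a
  system of `B`, `ι` finite);
* `SelfDualUnits.mixedSpace K` — the system of `K_∞ = mixedSpace K = ℝ^{r₁} × ℂ^{r₂}` of a
  number field `K` (units `e_w` for `w` real, `e_w, i e_w` for `w` complex; the example of the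
  docstring of `SelfDualUnits`), which removes the parameter `F` from
  `AutomorphicRepsGL.cuspidal_analyticAt_rightRegular_of_bounded_of_selfDualUnits`.

Everything is a definition with proved fields (no named fact, no instance); the only lemma is
`SelfDualUnits.frobenius_of_basis` (the Frobenius identity is linear in `x`, so it suffices to
check it on a real basis). Knapp 2002, §V.4 (dual bases of an invariant form and the Casimir
element; here for the trace forms of `ℝ`, `ℂ` and their finite products).

## References

* A. W. Knapp, *Lie Groups Beyond an Introduction*, 2nd ed. (2002), §V.4 [Knapp2002].
* Harish-Chandra, *Representations of a semisimple Lie group on a Banach space. I*, Trans. AMS 75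
  (1953), §11 [HarishChandraTAMS1953].
-/

open scoped TensorProduct ComplexConjugate
open Complex

noncomputable section

namespace Literature.NumberTheory.Automorphic

namespace SelfDualUnits

variable {A : Type*} [NormedCommRing A] [NormedAlgebra ℝ A] [NormedAlgebra ℚ A] [CompleteSpace A]
  [StarRing A] {B : Type*} [NormedCommRing B] [NormedAlgebra ℝ B] [NormedAlgebra ℚ B]
  [CompleteSpace B] [StarRing B] {S : Type*} [Fintype S] {S' : Type*} [Fintype S']

omit [NormedAlgebra ℚ A] [CompleteSpace A] [StarRing A] in
/-- **The Frobenius identity is linear in `x`**: if `∑ ε_s (bᵢ u_s) ⊗ u_s = ∑ ε_s u_s ⊗ (u_s bᵢ)`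
for the vectors `bᵢ` of a real basis of `A`, then `∑ ε_s (x u_s) ⊗ u_s = ∑ ε_s u_s ⊗ (u_s x)` for
all `x` (both sides are real-linear maps `A → A ⊗ A` in `x`). Knapp 2002, §V.4. [folklore] -/
theorem frobenius_of_basis {ι : Type*} (b : Module.Basis ι ℝ A) (u : S → A) (ε : S → ℝ)
    (h : ∀ i, ∑ s, ε s • ((b i * u s) ⊗ₜ[ℝ] u s) = ∑ s, ε s • (u s ⊗ₜ[ℝ] (u s * b i))) (x : A) :
    ∑ s, ε s • ((x * u s) ⊗ₜ[ℝ] u s) = ∑ s, ε s • (u s ⊗ₜ[ℝ] (u s * x)) := by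
  let f : A →ₗ[ℝ] A ⊗[ℝ] A :=
    ∑ s, ε s • ((TensorProduct.mk ℝ A A).flip (u s) ∘ₗ LinearMap.mulRight ℝ (u s))
  let g : A →ₗ[ℝ] A ⊗[ℝ] A :=
    ∑ s, ε s • (TensorProduct.mk ℝ A A (u s) ∘ₗ LinearMap.mulLeft ℝ (u s))
  have hf : ∀ y, f y = ∑ s, ε s • ((y * u s) ⊗ₜ[ℝ] u s) := fun y ↦ by
    simp only [f, LinearMap.sum_apply, LinearMap.smul_apply, LinearMap.comp_apply,
      LinearMap.mulRight_apply, LinearMap.flip_apply, TensorProduct.mk_apply]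
  have hg : ∀ y, g y = ∑ s, ε s • (u s ⊗ₜ[ℝ] (u s * y)) := fun y ↦ by
    simp only [g, LinearMap.sum_apply, LinearMap.smul_apply, LinearMap.comp_apply,
      LinearMap.mulLeft_apply, TensorProduct.mk_apply]
  have hfg : f = g := b.ext fun i ↦ by rw [hf, hg, h i]
  rw [← hf, ← hg, hfg]

/-- **The self-dual system of `ℝ`**: the single unit `1` with sign `1`. [folklore] -/
def real : SelfDualUnits ℝ Unit where
  u _ := 1
  ε _ := 1
  ε_sq _ := one_mul 1
  star_u _ := by rw [star_trivial, one_smul]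
  span_u := by
    rw [eq_top_iff]
    rintro x -
    have hx : x = x • (1 : ℝ) := (mul_one x).symm
    rw [hx]
    exact Submodule.smul_mem _ _ (Submodule.subset_span ⟨(), rfl⟩)
  frobenius x := by
    simp only [Finset.univ_unique, Finset.sum_singleton, one_smul, mul_one, one_mul]
    calc x ⊗ₜ[ℝ] (1 : ℝ) = (x • (1 : ℝ)) ⊗ₜ[ℝ] (1 : ℝ) := by rw [smul_eq_mul, mul_one]
      _ = (1 : ℝ) ⊗ₜ[ℝ] (x • (1 : ℝ)) := TensorProduct.smul_tmul x 1 1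
      _ = (1 : ℝ) ⊗ₜ[ℝ] x := by rw [smul_eq_mul, mul_one]

/-- **The self-dual system of `ℂ` as a real `*`-algebra**: the units `1, i` with signs `1, -1`
(`star i = -i`; `∑ ε_s u_s ⊗ u_s = 1 ⊗ 1 - i ⊗ i` is the Casimir tensor of the trace form
`Re(z w)`, equivalently `(1, i)` and `(1, -i)` are dual bases for it). Knapp 2002, §V.4 (the real
Casimir of `𝔤𝔩ₙ(ℂ)`: `∑ E_{ab}E_{ba} - (iE_{ab})(iE_{ba})`). [folklore] -/
def complex : SelfDualUnits ℂ (Fin 2) where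
  u := ![1, I]
  ε := ![1, -1]
  ε_sq s := by fin_cases s <;> simp
  star_u s := by
    fin_cases s
    · simp
    · simp [conj_I]
  span_u := by rw [← coe_basisOneI]; exact basisOneI.span_eq
  frobenius := by
    refine frobenius_of_basis basisOneI _ _ fun i ↦ ?_
    fin_cases i
    · simp [Fin.sum_univ_two]
    · simp [Fin.sum_univ_two, TensorProduct.neg_tmul, TensorProduct.tmul_neg]
      exact add_comm _ _

/-- **Products**: from self-dual systems of `A` and `B`, the system `(u_s, 0), (0, u'_t)` of
`A × B` (with the same signs). [folklore] -/
def prod (F : SelfDualUnits A S) (G : SelfDualUnits B S') : SelfDualUnits (A × B) (S ⊕ S') where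
  u := Sum.elim (fun s ↦ (F.u s, 0)) (fun t ↦ (0, G.u t))
  ε := Sum.elim F.ε G.ε
  ε_sq s := by
    cases s with
    | inl s => exact F.ε_sq s
    | inr t => exact G.ε_sq t
  star_u s := by
    cases s with
    | inl s =>
      change star (F.u s, (0 : B)) = F.ε s • (F.u s, (0 : B))
      rw [Prod.star_def, Prod.smul_mk, F.star_u, star_zero, smul_zero]
    | inr t =>
      change star ((0 : A), G.u t) = G.ε t • ((0 : A), G.u t)
      rw [Prod.star_def, Prod.smul_mk, G.star_u, star_zero, smul_zero]
  span_u := by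
    rw [eq_top_iff]
    rintro ⟨a, b⟩ -
    have ha : (a, (0 : B)) ∈ Submodule.span ℝ
        (Set.range (Sum.elim (fun s ↦ (F.u s, (0 : B))) (fun t ↦ ((0 : A), G.u t)))) := by
      have h1 : a ∈ Submodule.span ℝ (Set.range F.u) := by rw [F.span_u]; trivial
      have h2 := Submodule.mem_map_of_mem (f := LinearMap.inl ℝ A B) h1
      rw [Submodule.map_span] at h2
      refine Submodule.span_mono ?_ h2
      rintro _ ⟨_, ⟨s, rfl⟩, rfl⟩
      exact ⟨Sum.inl s, rfl⟩
    have hb : ((0 : A), b) ∈ Submodule.span ℝ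
        (Set.range (Sum.elim (fun s ↦ (F.u s, (0 : B))) (fun t ↦ ((0 : A), G.u t)))) := by
      have h1 : b ∈ Submodule.span ℝ (Set.range G.u) := by rw [G.span_u]; trivial
      have h2 := Submodule.mem_map_of_mem (f := LinearMap.inr ℝ A B) h1
      rw [Submodule.map_span] at h2
      refine Submodule.span_mono ?_ h2
      rintro _ ⟨_, ⟨t, rfl⟩, rfl⟩
      exact ⟨Sum.inr t, rfl⟩
    have hab : ((a, b) : A × B) = (a, 0) + (0, b) := by rw [Prod.mk_add_mk, add_zero, zero_add]
    rw [hab]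
    exact Submodule.add_mem _ ha hb
  frobenius x := by
    obtain ⟨x₁, x₂⟩ := x
    rw [Fintype.sum_sum_type, Fintype.sum_sum_type]
    simp only [Sum.elim_inl, Sum.elim_inr, Prod.mk_mul_mk, mul_zero, zero_mul]
    have e₁ := congrArg (TensorProduct.map (LinearMap.inl ℝ A B) (LinearMap.inl ℝ A B))
      (F.frobenius x₁)
    have e₂ := congrArg (TensorProduct.map (LinearMap.inr ℝ A B) (LinearMap.inr ℝ A B))
      (G.frobenius x₂)
    simp only [map_sum, map_smul, TensorProduct.map_tmul, LinearMap.inl_apply,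
      LinearMap.inr_apply] at e₁ e₂
    rw [e₁, e₂]

/-- **Powers**: from a self-dual system of `B`, the system `e_i u_s` (`Pi.single i (u s)`) of
`ι → B` for a finite index type `ι` (with the same signs). [folklore] -/
def pi {ι : Type*} [Fintype ι] [DecidableEq ι] (F : SelfDualUnits B S) :
    SelfDualUnits (ι → B) (ι × S) where
  u p := Pi.single p.1 (F.u p.2)
  ε p := F.ε p.2
  ε_sq p := F.ε_sq p.2
  star_u p := by rw [Pi.star_single, F.star_u, Pi.single_smul']
  span_u := by
    rw [eq_top_iff]
    rintro x -
    rw [← Finset.univ_sum_single x]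
    refine Submodule.sum_mem _ fun i _ ↦ ?_
    have h1 : x i ∈ Submodule.span ℝ (Set.range F.u) := by rw [F.span_u]; trivial
    have h2 := Submodule.mem_map_of_mem (f := LinearMap.single ℝ (fun _ : ι ↦ B) i) h1
    rw [Submodule.map_span] at h2
    refine Submodule.span_mono ?_ h2
    rintro _ ⟨_, ⟨s, rfl⟩, rfl⟩
    exact ⟨(i, s), rfl⟩
  frobenius x := by
    rw [Fintype.sum_prod_type, Fintype.sum_prod_type]
    refine Finset.sum_congr rfl fun i _ ↦ ?_
    have e := congrArg (TensorProduct.map (LinearMap.single ℝ (fun _ : ι ↦ B) i)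
      (LinearMap.single ℝ (fun _ : ι ↦ B) i)) (F.frobenius (x i))
    simp only [map_sum, map_smul, TensorProduct.map_tmul, LinearMap.coe_single] at e
    simp only [← Pi.single_mul_right, ← Pi.single_mul_left]
    exact e

open scoped Classical in
/-- **The self-dual system of units of `K_∞ = mixedSpace K = ℝ^{r₁} × ℂ^{r₂}`** of a number
field `K`: the units `e_w` (`w` real), `e_w, i e_w` (`w` complex) with signs `1, 1, -1`
(`SelfDualUnits.prod` of `SelfDualUnits.pi real` and `SelfDualUnits.pi complex`). This is the
example in the docstring of `SelfDualUnits` (`RealCasimirGL`); its Casimir element is the sum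
over the archimedean places of the real Casimirs of `𝔤𝔩ₙ(ℝ)` and `𝔤𝔩ₙ(ℂ)`. Knapp 2002, §V.4;
Harish-Chandra 1953, §11. [folklore] -/
def mixedSpace (K : Type*) [Field K] [NumberField K] :
    SelfDualUnits (NumberField.mixedEmbedding.mixedSpace K)
      (({w : NumberField.InfinitePlace K // w.IsReal} × Unit) ⊕
        ({w : NumberField.InfinitePlace K // w.IsComplex} × Fin 2)) :=
  (pi real).prod (pi complex)

end SelfDualUnits

end Literature.NumberTheory.Automorphic
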